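import Literature.NumberTheory.Automorphic.ArchParameterTwistNorm
import Literature.NumberTheory.Automorphic.AutomorphicLieDerivSkewAdjoint
import Literature.NumberTheory.Automorphic.AutomorphicRepDataSplitCenter
import Literature.NumberTheory.Automorphic.AutomorphicRepsGLCuspFormsSquareIntegrable
import Literature.NumberTheory.Automorphic.IdeleNormDetGL
import Literature.NumberTheory.Automorphic.KugaLemmaDegreeOne
import HarnessLib

/-!
# The Petersson form on a clean cuspidal automorphic representation of `GL_n`, unitarily
# normalised, and the skew-adjointness of the Lie derivatives of norm exponent zero

Let `π = W / W'` be an automorphic representation datum of `GL_n(𝔸_K)` (Borel–Jacquet model) with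
`W ≤ 𝒜₀` (cusp forms) and `W' = ⊥`.  The split component `A_G` acts on `W` by `a ↦ a^μ`
(`AutomorphicRepData.exists_apply_posRealScalar_mul_eq_cpow`), so for `s = -μ / (n [K:ℚ])` the
twisted forms `|det|^s φ`, `φ ∈ W`, are cusp forms invariant under `A_G · GL_n(K)`
(`mulChar_detTwist_apply_posRealScalar_mul_of_cpow`): a **unitary twist** (`UnitaryTwist`,
`nonempty_unitaryTwist`).  Reading them on the automorphic quotient (`UnitaryTwist.form`) and
integrating against an automorphic measure gives the **Petersson form**
`⟪φ, ψ⟫ = ∫ \overline{(|det|^s φ)↓} (|det|^s ψ)↓ dμ` on `W` (`UnitaryTwist.pet`), a positive definite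
Hermitian form (`isPosForm_pet`; definiteness from the continuity of cusp forms and the full support
of the measure), for which **the Lie derivative along any `X ∈ 𝔤` of norm exponent
`λ(X) = ∑_{w real} tr X_w + ∑_{w complex} 2 re tr X_w = 0` is skew-adjoint**
(`pet_lieDerivW_left`: the twist commutes with such `X`, `lieDeriv_mulChar_detTwist_of_cpow`, and
integration by parts on the quotient, `integral_cuspFormsGL_lieDeriv_mul_conj_eq_neg`).
Borel–Jacquet 1979, 5.7 ("we may assume `π` unitary"); Borel 1997, 11.12 (2); Harder 1987, §3.1.
[cite: BorelJacquetCorvallis1979, 5.7] [cite: Borel1997, 11.12 (2)] [cite: Harder1987, §3.1]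

One structure (`UnitaryTwist`), two definitions (`form`, `pet`), theorems; no named fact.
-/

noncomputable section

-- Mathlib idiom (Mathlib/Algebra/Lie/OfAssociative.lean), as in `ArchParameterTwistNorm`.
attribute [local instance 100] LieRing.ofAssociativeRing

open scoped Matrix ComplexConjugate Classical NNReal
open Complex NumberField NumberField.mixedEmbedding NumberField.InfinitePlace IsDedekindDomain
open _root_.MeasureTheory _root_.MeasureTheory.Measure

namespace Literature.NumberTheory.Automorphic

namespace AutomorphicRepData

open Literature.NumberTheory.GaloisRepresentations (HeckeCharacter ideleGroup)

variable {n : ℕ} {K : Type} [Field K] [NumberField K] {hcpt : isCompact_glFiniteIntegralLevel n K}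
  (π : AutomorphicRepData (AutomorphyDatum.gl n K hcpt))

/-- A **unitary twist** of `π`: a Hecke character `χ = |·|_𝔸^s` such that the twisted forms
`(χ ∘ det) · φ`, `φ ∈ W`, are cusp forms invariant under `A_G · GL_n(K)`.
[cite: BorelJacquetCorvallis1979, 5.7] -/
structure UnitaryTwist where
  /-- the Hecke character `|·|_𝔸^s` -/
  χ : HeckeCharacter K
  /-- its exponent -/
  s : ℂ
  hχ : ∀ x : ideleGroup K, ((χ x : ℂˣ) : ℂ) = (GaloisRepresentations.ideleNorm x : ℂ) ^ s
  cusp : ∀ φ ∈ π.W, mulChar (detTwist n χ) φ ∈ cuspFormsGL n K hcpt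
  inv : ∀ φ ∈ π.W, ∀ γ ∈ (AdelicGroupData.gl n K).quotientSubgroup, ∀ g,
    mulChar (detTwist n χ) φ (γ * g) = mulChar (detTwist n χ) φ g

/-- **A clean cuspidal `π` has a unitary twist** (`s = -μ / (n[K:ℚ])` for the exponent `μ` of
`A_G` on `W`). [cite: BorelJacquetCorvallis1979, 5.7] -/
theorem nonempty_unitaryTwist [NeZero n] (hcuspW : π.W ≤ cuspFormsGL n K hcpt) (h : π.W' = ⊥) :
    Nonempty (UnitaryTwist π) := by
  obtain ⟨μ, hμ⟩ := π.exists_apply_posRealScalar_mul_eq_cpow h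
  set s : ℂ := -μ / ((n * Module.finrank ℚ K : ℕ) : ℂ) with hs_def
  obtain ⟨χ, hχ⟩ := exists_heckeCharacter_ideleNorm_cpow (K := K) s
  have hN : ((n * Module.finrank ℚ K : ℕ) : ℂ) ≠ 0 := by
    have : 0 < n * Module.finrank ℚ K := Nat.mul_pos (Nat.pos_of_ne_zero (NeZero.ne n)) Module.finrank_pos
    exact_mod_cast this.ne'
  have hs : s * (n * Module.finrank ℚ K : ℕ) = -μ := by rw [hs_def, div_mul_cancel₀ _ hN]
  have hcusp : ∀ φ ∈ π.W, mulChar (detTwist n χ) φ ∈ cuspFormsGL n K hcpt := fun φ hφ =>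
    map_mulChar_detTwist_le_cuspFormsGL_of_cpow hχ hcuspW ⟨φ, hφ, rfl⟩
  refine ⟨⟨χ, s, hχ, hcusp, fun φ hφ => ?_⟩⟩
  refine (AdelicGroupData.gl n K).leftInvariant_quotientSubgroup
    (isLeftInvariant_of_mem_automorphicForms (cuspFormsGL_le_automorphicForms n K hcpt (hcusp φ hφ))) ?_
  rintro _ ⟨t, rfl⟩ g
  exact mulChar_detTwist_apply_posRealScalar_mul_of_cpow hχ hs (hμ φ hφ) t g

namespace UnitaryTwist

variable {π} (T : UnitaryTwist π)

/-- **The twisted form read on the automorphic quotient**: `φ ↦ (|det|^s φ)↓`, the function on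
`GL_n(𝔸_K) ⧸ A_G GL_n(K)` whose inversion `invQuot` is `|det|^s φ`. [cite: BorelJacquetCorvallis1979, 4.2] -/
def form (x : π.W) : (AdelicGroupData.gl n K).automorphicQuotient → ℂ :=
  (AdelicGroupData.gl n K).descend (mulChar (detTwist n T.χ) (x : (AdelicGroupData.gl n K).Adelic → ℂ))
    (T.inv x x.2)

/-- `invQuot (form x) = |det|^s x`. [folklore] -/
@[simp] theorem invQuot_form (x : π.W) :
    invQuot (AdelicGroupData.gl n K) (T.form x) =
      mulChar (detTwist n T.χ) (x : (AdelicGroupData.gl n K).Adelic → ℂ) :=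
  (AdelicGroupData.gl n K).invQuot_descend _ _

/-- `invQuot (form x)` is a cusp form. [cite: BorelJacquetCorvallis1979, 4.6] -/
theorem invQuot_form_mem (x : π.W) :
    invQuot (AdelicGroupData.gl n K) (T.form x) ∈ cuspFormsGL n K hcpt := by
  rw [invQuot_form]; exact T.cusp x x.2

/-- The dictionary `invQuot` is injective. [folklore] -/
theorem invQuot_injective :
    Function.Injective (invQuot (AdelicGroupData.gl n K) : ((AdelicGroupData.gl n K).automorphicQuotient → ℂ) → _) := by
  intro f g hfg
  funext q
  obtain ⟨y, rfl⟩ := QuotientGroup.mk_surjective q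
  have := congrFun hfg y⁻¹
  rwa [invQuot_apply, invQuot_apply, inv_inv] at this

/-- `form` is additive. [folklore] -/
theorem form_add (x y : π.W) : T.form (x + y) = T.form x + T.form y := by
  apply invQuot_injective
  rw [invQuot_form]
  change _ = invQuot (AdelicGroupData.gl n K) (T.form x) + invQuot (AdelicGroupData.gl n K) (T.form y)
  rw [invQuot_form, invQuot_form, Submodule.coe_add, map_add]

/-- `form` is homogeneous. [folklore] -/
theorem form_smul (c : ℂ) (x : π.W) : T.form (c • x) = c • T.form x := by
  apply invQuot_injective
  rw [invQuot_form]
  change _ = c • invQuot (AdelicGroupData.gl n K) (T.form x)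
  rw [invQuot_form, Submodule.coe_smul, map_smul]

/-- `form x = 0 ↔ x = 0` (the character `|det|^s` does not vanish). [folklore] -/
theorem form_eq_zero_iff (x : π.W) : T.form x = 0 ↔ x = 0 := by
  constructor
  · intro h0
    have h1 := T.invQuot_form x
    rw [h0] at h1
    have h2 : mulChar (detTwist n T.χ) (x : (AdelicGroupData.gl n K).Adelic → ℂ) = 0 := by
      rw [← h1]; rfl
    ext g
    have := congrFun h2 g
    rw [mulChar_apply, Pi.zero_apply, mul_eq_zero] at this
    rcases this with h | h
    · exact absurd h (Units.ne_zero _)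
    · simpa using h
  · rintro rfl
    apply invQuot_injective
    rw [invQuot_form, Submodule.coe_zero, map_zero]; rfl

/-- `form x` is continuous and bounded. [cite: BorelJacquetCorvallis1979, 4.3] -/
theorem continuous_form (x : π.W) : Continuous (T.form x) ∧ ∃ C : ℝ, ∀ q, ‖T.form x q‖ ≤ C :=
  continuous_and_bounded_of_invQuot_mem_cuspFormsGL (T.invQuot_form_mem x)

variable (μ : Measure (AdelicGroupData.gl n K).automorphicQuotient)

/-- **The Petersson form** `⟪x, y⟫ = ∫ \overline{(|det|^s x)↓} (|det|^s y)↓ dμ` on `W`.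
[cite: Borel1997, 11.12 (2)] [cite: Harder1987, §3.1] -/
def pet (x y : π.W) : ℂ :=
  ∫ q, conj (T.form x q) * T.form y q ∂μ

variable [(AdelicGroupData.gl n K).IsAutomorphicMeasure μ]

/-- `form x ∈ L²(μ)`. [folklore] -/
theorem memLp_form (x : π.W) : MemLp (T.form x) 2 μ :=
  memLp_two_of_invQuot_mem_cuspFormsGL (T.invQuot_form_mem x)

/-- The integrand of the Petersson form is integrable. [folklore] -/
theorem integrable_conj_mul (x y : π.W) :
    Integrable (fun q => conj (T.form x q) * T.form y q) μ := by
  have hx : MemLp (fun q => conj (T.form x q)) 2 μ := by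
    obtain ⟨hc, C, hC⟩ := T.continuous_form x
    exact memLp_two_of_continuous_of_bound (Complex.continuous_conj.comp hc) fun q =>
      (Complex.norm_conj (T.form x q)).le.trans (hC q)
  exact hx.integrable_mul (T.memLp_form μ y)

/-- **The Petersson form is a positive definite Hermitian form on `W`.** [cite: Borel1997, 11.12 (2)] -/
theorem isPosForm_pet : Kuga.IsPosForm (T.pet μ) where
  add_left x y z := by
    simp only [pet, form_add, Pi.add_apply, map_add, add_mul]
    exact integral_add (T.integrable_conj_mul μ x z) (T.integrable_conj_mul μ y z)
  smul_left c x y := by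
    simp only [pet, form_smul, Pi.smul_apply, smul_eq_mul, map_mul, mul_assoc]
    exact integral_const_mul _ _
  conj_symm x y := by
    rw [pet, pet, ← integral_conj]
    refine integral_congr_ae (Filter.Eventually.of_forall fun q => ?_)
    simp only [map_mul, Complex.conj_conj, mul_comm]
  nonneg x := by
    rw [pet]
    have : ∀ q, conj (T.form x q) * T.form x q = ((‖T.form x q‖ ^ 2 : ℝ) : ℂ) := fun q => by
      rw [Complex.conj_mul', ← Complex.ofReal_pow]
    simp_rw [this, integral_complex_ofReal, Complex.ofReal_re]
    exact integral_nonneg fun q => sq_nonneg _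
  definite x hx := by
    rw [pet] at hx
    have hq : ∀ q, conj (T.form x q) * T.form x q = ((‖T.form x q‖ ^ 2 : ℝ) : ℂ) := fun q => by
      rw [Complex.conj_mul', ← Complex.ofReal_pow]
    simp_rw [hq, integral_complex_ofReal, Complex.ofReal_eq_zero] at hx
    obtain ⟨hc, C, hC⟩ := T.continuous_form x
    have hint : Integrable (fun q => ‖T.form x q‖ ^ 2) μ := by
      have := (T.integrable_conj_mul μ x x).re
      refine this.congr (Filter.Eventually.of_forall fun q => ?_)
      simp only [hq, RCLike.re_to_complex, Complex.ofReal_re]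
    have hae := (integral_eq_zero_iff_of_nonneg (fun q => sq_nonneg _) hint).1 hx
    -- a continuous function vanishing a.e. for a measure positive on opens vanishes
    have hzero : (fun q => ‖T.form x q‖ ^ 2) = 0 :=
      Continuous.ae_eq_iff_eq μ (by fun_prop) continuous_const |>.1 hae
    rw [← T.form_eq_zero_iff]
    funext q
    have := congrFun hzero q
    simp only [Pi.zero_apply, pow_eq_zero_iff two_ne_zero, norm_eq_zero] at this
    exact this

/-- **Integration by parts: Lie derivatives of norm exponent zero are skew-adjoint for the
Petersson form.** For `X ∈ 𝔤` with `λ(X) = ∑_{w real} tr X_w + ∑_{w complex} 2 re tr X_w = 0`: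
`⟪X x, y⟫ = -⟪x, X y⟫`. [cite: Borel1997, 11.12 (2)] [cite: Harder1987, §3.1] -/
theorem pet_lieDerivW_left (X : (AutomorphyDatum.gl n K hcpt).arch.lie)
    (hX : ((∑ w, (X : Matrix (Fin n) (Fin n) (mixedSpace K)).trace.1 w) +
      ∑ w, 2 * ((X : Matrix (Fin n) (Fin n) (mixedSpace K)).trace.2 w).re) = 0)
    (x y : π.W) :
    T.pet μ (π.lieDerivW X x) y = -T.pet μ x (π.lieDerivW X y) := by
  obtain ⟨lam, -, hlam⟩ := exists_normExponent (n := n) (K := K) hcpt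
  have hlamX : lam X = 0 := by rw [hlam, hX]
  -- the twist commutes with `X`
  have hder : ∀ z : π.W, lieDeriv (AutomorphyDatum.gl n K hcpt).ofArch X
      (invQuot (AdelicGroupData.gl n K) (T.form z)) =
        invQuot (AdelicGroupData.gl n K) (T.form (π.lieDerivW X z)) := fun z => by
    rw [invQuot_form, invQuot_form, π.lieDeriv_mulChar_detTwist_of_cpow T.hχ hlam X z, hlamX,
      Complex.ofReal_zero, mul_zero, zero_smul, add_zero]
  have key := integral_cuspFormsGL_lieDeriv_mul_conj_eq_neg (μ := μ) (T.invQuot_form_mem x)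
    (T.invQuot_form_mem y) X (hder x) (hder y)
  -- conjugate
  have e1 : T.pet μ (π.lieDerivW X x) y = conj (∫ q, T.form (π.lieDerivW X x) q * conj (T.form y q) ∂μ) := by
    rw [pet, ← integral_conj]
    refine integral_congr_ae (Filter.Eventually.of_forall fun q => ?_)
    simp only [map_mul, Complex.conj_conj, mul_comm]
  have e2 : T.pet μ x (π.lieDerivW X y) = conj (∫ q, T.form x q * conj (T.form (π.lieDerivW X y) q) ∂μ) := by
    rw [pet, ← integral_conj]
    refine integral_congr_ae (Filter.Eventually.of_forall fun q => ?_)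
    simp only [map_mul, Complex.conj_conj]
  rw [e1, e2, key, map_neg]

/-- Symmetric form of the skew-adjointness: `⟪x, X y⟫ = -⟪X x, y⟫`. [cite: Borel1997, 11.12 (2)] -/
theorem pet_lieDerivW_right (X : (AutomorphyDatum.gl n K hcpt).arch.lie)
    (hX : ((∑ w, (X : Matrix (Fin n) (Fin n) (mixedSpace K)).trace.1 w) +
      ∑ w, 2 * ((X : Matrix (Fin n) (Fin n) (mixedSpace K)).trace.2 w).re) = 0)
    (x y : π.W) :
    T.pet μ x (π.lieDerivW X y) = -T.pet μ (π.lieDerivW X x) y := by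
  rw [T.pet_lieDerivW_left μ X hX, neg_neg]

end UnitaryTwist

end AutomorphicRepData

end Literature.NumberTheory.Automorphic

end
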